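/-
Copyright (c) 2026 the pub-hodgecm-mathlib formalisation cell (harness21).  Prover seat hodgecm-mathlib-F0P3a-p09 (g15); E1 keeper ∕ dealer F0P3a-p03 (g30), E1 BRICK
LEDGER row 53 «ELLIPTIC ⇔ FINITE NON-EMPTY FIXED TREE AT THE PINS» (charter gap (d); census `F0/P3a/F0P3a-p09/g15/r53/CENSUS-R53.v1` aea43347, keeper ruling 2026-09-03T03:08:47Z
«= ROUTE — ORBIT METHOD»).
-/
import Summits.HodgeConjecture.HodgeConjecture.Theorems.F0P3cStCharTSCharacterEllipticUniform   -- ★ 41g-H (LH6-p04 (g11)): the (G3)-EXPLICIT tree letters `(w hw ϖ hd eA) {a} (ha)`, `isOpen_setOf_actionHom_apply_eq`, §1 transport; brings ★ 41g-P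
import Summits.HodgeConjecture.HodgeConjecture.Theorems.F0P3cStCharTSEllCartanCompact             -- ★ (F0P3a-p05): `isCompact_centralizer_of_not_mem_hyperbolicSet`, `…_iff_…` (`Ω = hyperbolicSet L v`)
import Literature.NumberTheory.Automorphic.UnitOrbitalIntegralFixedPoints                          -- ★ `finite_fixedBy_quotient_of_isClosed` (closed class + compact centraliser ⇒ finite fixed cosets)
import Literature.NumberTheory.Automorphic.LocalRegularOrbitClosed                                 -- ★ `UnitaryGroup.isClosed_conjClass_local_of_isRegularElt`
import Literature.NumberTheory.Automorphic.UnitaryLatticeTreeNoInversion                           -- ★ row 30 `exists_coloring_type` (no inversion)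
import Literature.NumberTheory.Automorphic.UnitaryLatticeTreeGeodesicApartment                     -- ★ row 39γ `exists_apartmentEnum`, `…_of_isSelfDualLattice`, `…_neg_one` (two vertex orbits)
import Literature.NumberTheory.Automorphic.UnitaryLatticeTreeTypes                                 -- ★ `type_eq_zero_or_two_of_isVertexLattice_three`
import Literature.Combinatorics.SimpleGraph.TreeAutomorphismFiniteInvariantFacet                    -- ★ TITS `exists_fixed_or_swap_adj_of_finite_invariant`
import Literature.Topology.Algebra.CompactOrbitFinite                                              -- ★ N1 (LH5-p05 (g12)): `finite_image_act_of_isCompact` (compact × open fibres ⇒ finite image)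
import HarnessLib

/-!
# Row 53 — A REGULAR ELLIPTIC `γ` HAS A NON-EMPTY FINITE FIXED TREE (the `hne ∕ hfin ∕ hfinE` binders of ★ 41g-H at the pins)

Cell `pub/hodgecm-mathlib`, crux H413 = `stmt-HodgeConjecture-24833` (`--supports` lane, helper, THEOREMS ONLY: no definition ∕ instance ∕ notation ∕ named fact ∕ `sorry`).
Namespace `Summit.HodgeConjecture.HodgeConjecture.Cruxes.H413.F0P3cStCharTSEllipticFixedTree`.  E1 BRICK LEDGER row 53 (keeper F0P3a-p03 (g30) 03:01:38Z → F0P3a-p09 (g15);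
census-first «ORBIT METHOD» «=» 03:08:47Z).  HONEST LABEL: count-neutral datum helper; (R-SS) banked for K1 at unramified places only; E1 = PRINT until the keeper's charter
test + LEAD words; HC_CM is proved only modulo the 7 printed citations (2 remaining named inputs hLiu418 = stmt-HodgeConjecture-24832, h413 = stmt-HodgeConjecture-24833) until
rung 0 closes.

THE MATHEMATICS (Kottwitz 1986 §3; Rogawski 1990 §3.6, §12.5; Serre, *Trees* I.6.5, II.1; Bruhat–Tits 1972 §10).  `G = U(Φ₃)(L⁺_v)` at a non-split unramified `v`, acting
(through the (G3) iso `eA` and the action hom `a`) on its Bruhat–Tits tree, the lattice graph `X` of ★ T1a.  For `γ ∈ G` REGULAR with COMPACT centraliser `Z(γ)` (⟺ `γ ∉ Ω`,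
the regular hyperbolic set, ★ `isCompact_centralizer_iff_not_mem_hyperbolicSet`; ⟺ `γ ∈ 𝔇.ellG` at the pins):
* §1 (generic) the fibres `{g | f g x₀ = y}` of an action with an OPEN stabiliser set are open, so a compact set moves `x₀` to finitely many points (★ N1
  `Literature.Topology.Algebra.finite_image_act_of_isCompact`, LH5-p05 (g12));
* §2 `hne`: the orbit `Z(γ)·o₀` of any vertex is finite, non-empty and `γ`-invariant, so by ★ TITS (`exists_fixed_or_swap_adj_of_finite_invariant`) `γ` fixes a vertex or swaps
  two adjacent ones — and the swap is impossible because `G` preserves the vertex TYPE (★ no-inversion colouring `exists_coloring_type`);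
* §3 `hfin`: for each base vertex `x₀` with (compact open) stabiliser `K`, the `γ`-fixed vertices of the orbit `G·x₀` are images of the FINITE set `Fix_γ(G ⧸ K)` (★
  `finite_fixedBy_quotient_of_isClosed`: the class of a regular `γ` is closed ★, `Z(γ)` is compact); the two orbits (types `0` and `2`, ★ 39γ + ★ `type_eq_zero_or_two…`) cover `X`;
* §4 `hfinE`: a fixed edge has fixed endpoints (★ `head_mapEdgeSet_latticeGraphIso`), so the fixed edges inject into `Fix × Fix`;
* §5 the pin-shaped junctions: `γ ∈ 𝔇.ellG` ⇒ `hne ∧ hfin ∧ hfinE`; `γ ∈ 𝔇.regG ∖ 𝔇.ellG` ⇒ `Z(γ)` non-compact ((d2)).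

## References
* [Kottwitz1986] R. Kottwitz, *Base change for unit elements of Hecke algebras*, Compositio Math. 60 (1986), §3 (fixed points of elliptic elements on the building are finite).
* [Rogawski1990] J. D. Rogawski, *Automorphic Representations of Unitary Groups in Three Variables* (1990), §3.6 pp. 28–31 (Cartan subgroups), §12.5 pp. 182–187.
* [Serre1980Trees] J.-P. Serre, *Trees* (1980), I.6.5 Prop. 26 (bounded actions fix a vertex or an edge), II.1.1 (the tree of `SL₂` ∕ lattices).
* [BruhatTits1972] F. Bruhat, J. Tits, *Groupes réductifs sur un corps local I*, Publ. Math. IHÉS 41 (1972), §10 (§3.2 fixed points of bounded subgroups).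
-/

set_option autoImplicit false

set_option linter.dupNamespace false

noncomputable section

open NumberField IsDedekindDomain MeasureTheory
open scoped Pointwise Valued WithZero Matrix
open Literature.NumberTheory.Rogawski1990 Literature.NumberTheory.Rogawski1990.Ch12Sec5
open Literature.NumberTheory.Automorphic Literature.NumberTheory.Automorphic.UnitaryGroup Literature.NumberTheory.Automorphic.UnitaryLatticeTree
open Literature.NumberTheory.Automorphic.HermitianLattice
open Literature.Combinatorics.SimpleGraph Literature.Combinatorics.SimpleGraph.OrientedIncidence

namespace Summit.HodgeConjecture.HodgeConjecture.Cruxes.H413.F0P3cStCharTSEllipticFixedTree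

open Summit.HodgeConjecture.HodgeConjecture.Cruxes.H413
open F0P3cStCharTSCharacterEllipticUniform F0P3cStCharTSTorusDefs

/-! ## §1 Finite orbits of a compact set acting with open fibres (generic) -/

section Generic

variable {G X : Type*} [TopologicalSpace G]

variable [Group G] [ContinuousMul G]

/-- For an action `f` of a topological group by maps (`f (g h) = f g ∘ f h`, `f 1 = id`) whose stabiliser set `{g | f g x₀ = x₀}` is OPEN, every fibre `{g | f g x₀ = y}` is open
(empty, or a left translate of the stabiliser). [cite: BruhatTits1972, §3.2] -/
theorem isOpen_setOf_act_apply_eq (f : G → X → X) (hmul : ∀ g h x, f (g * h) x = f g (f h x)) (hone : ∀ x, f 1 x = x) (x₀ : X)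
    (h : IsOpen {g : G | f g x₀ = x₀}) (y : X) : IsOpen {g : G | f g x₀ = y} := by
  by_cases hy : ∃ g₀ : G, f g₀ x₀ = y
  · obtain ⟨g₀, hg₀⟩ := hy
    have hset : {g : G | f g x₀ = y} = (fun g => g₀⁻¹ * g) ⁻¹' {g : G | f g x₀ = x₀} := by
      ext g
      simp only [Set.mem_setOf_eq, Set.mem_preimage]
      constructor
      · intro hg
        rw [hmul, hg, ← hg₀, ← hmul, inv_mul_cancel, hone]
      · intro hg
        have h2 : f g₀ (f (g₀⁻¹ * g) x₀) = y := by rw [hg, hg₀]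
        rwa [← hmul, mul_inv_cancel_left] at h2
    rw [hset]
    exact h.preimage (continuous_const_mul g₀⁻¹)
  · have hset : {g : G | f g x₀ = y} = ∅ := Set.eq_empty_iff_forall_notMem.2 fun g hg => hy ⟨g, hg⟩
    rw [hset]
    exact isOpen_empty

end Generic

/-! ## §2 The datum: stabilisers, the finite `Z(γ)`-orbit, and the fixed vertex (`hne`) -/

section Datum

variable (L : Type) [Field L] [NumberField L] [IsCMField L] (v : HeightOneSpectrum (𝓞 ↥(maximalRealSubfield L)))
  (w : PlacesOver L v) (hw : IsCMField.complexConj L • w.1 = w.1) {ϖ : w.1.adicCompletion L}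
  (eA : Gqs L v ≃ₜ* ↥(unitaryGroupOfForm (galAdicCompletionMap (L := L) (IsCMField.complexConj L) hw) ((StdForm.antidiagonal 3).over (w.1.adicCompletion L))))
  {a : Gqs L v →* ((latticeGraph (galAdicCompletionMap (L := L) (IsCMField.complexConj L) hw) ϖ ((StdForm.antidiagonal 3).over (w.1.adicCompletion L))) ≃g (latticeGraph (galAdicCompletionMap (L := L) (IsCMField.complexConj L) hw) ϖ ((StdForm.antidiagonal 3).over (w.1.adicCompletion L))))}
  (ha : ∀ g, a g = latticeGraphIso (galAdicCompletionMap (L := L) (IsCMField.complexConj L) hw) ϖ ((StdForm.antidiagonal 3).over (w.1.adicCompletion L)) (eA g))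

include ha in
/-- **VERTEX STABILISERS IN `Gqs L v` ARE COMPACT OPEN SUBGROUPS** (★ 41g-P `exists_stabilizerSubgroup` pulled back along `eA`; the 41g-H `hPo ∕ hPc` lines as a lemma).
[cite: BruhatTits1972, §3.2] [cite: Serre1980Trees, II.1.1] -/
theorem exists_stabilizer_isOpen_isCompact (x : {M : Submodule 𝒪[(w.1.adicCompletion L)] (Fin 3 → (w.1.adicCompletion L)) // IsVertex (galAdicCompletionMap (L := L) (IsCMField.complexConj L) hw) ϖ ((StdForm.antidiagonal 3).over (w.1.adicCompletion L)) M}) :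
    ∃ P : Subgroup (Gqs L v), (∀ g, g ∈ P ↔ a g x = x) ∧ IsOpen (P : Set (Gqs L v)) ∧ IsCompact (P : Set (Gqs L v)) := by
  obtain ⟨P₀, hP₀⟩ := exists_stabilizerSubgroup (galAdicCompletionMap (L := L) (IsCMField.complexConj L) hw) ϖ ((StdForm.antidiagonal 3).over (w.1.adicCompletion L)) x
  have hPmem : ∀ g : Gqs L v, g ∈ P₀.comap eA.toMonoidHom ↔ a g x = x := fun g => by rw [mem_comap_iff', hP₀, ha]
  refine ⟨P₀.comap eA.toMonoidHom, hPmem, ?_, ?_⟩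
  · have hset : ((P₀.comap eA.toMonoidHom : Subgroup (Gqs L v)) : Set (Gqs L v)) = {g : Gqs L v | a g x = x} := Set.ext hPmem
    rw [hset]; exact isOpen_setOf_actionHom_apply_eq ha x
  · haveI := compactSpace_integer_adicCompletion L w.1
    have hset : (P₀ : Set ↥(unitaryGroupOfForm (galAdicCompletionMap (L := L) (IsCMField.complexConj L) hw) ((StdForm.antidiagonal 3).over (w.1.adicCompletion L)))) = {u | latticeGraphIso (galAdicCompletionMap (L := L) (IsCMField.complexConj L) hw) ϖ ((StdForm.antidiagonal 3).over (w.1.adicCompletion L)) u x = x} := Set.ext hP₀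
    refine isCompact_coe_comap eA P₀ ?_
    rw [hset]
    exact isCompact_setOf_latticeGraphIso_apply_eq (galAdicCompletionMap (L := L) (IsCMField.complexConj L) hw) ϖ ((StdForm.antidiagonal 3).over (w.1.adicCompletion L)) (continuous_galAdicCompletionMap L (IsCMField.complexConj L) hw) x

include ha in
/-- **THE `Z(γ)`-ORBIT OF A VERTEX IS FINITE** when `Z(γ)` is compact (§1 with the open stabilisers of §2). [cite: Kottwitz1986, §3] [cite: BruhatTits1972, §3.2] -/
theorem finite_image_centralizer_apply {γ : Gqs L v} (hZc : IsCompact ((Subgroup.centralizer ({γ} : Set (Gqs L v))) : Set (Gqs L v))) (x₀ : {M : Submodule 𝒪[(w.1.adicCompletion L)] (Fin 3 → (w.1.adicCompletion L)) // IsVertex (galAdicCompletionMap (L := L) (IsCMField.complexConj L) hw) ϖ ((StdForm.antidiagonal 3).over (w.1.adicCompletion L)) M}) :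
    ((fun c : Gqs L v => a c x₀) '' ((Subgroup.centralizer ({γ} : Set (Gqs L v))) : Set (Gqs L v))).Finite :=
  Literature.Topology.Algebra.finite_image_act_of_isCompact (fun g (x : {M : Submodule 𝒪[(w.1.adicCompletion L)] (Fin 3 → (w.1.adicCompletion L)) // IsVertex (galAdicCompletionMap (L := L) (IsCMField.complexConj L) hw) ϖ ((StdForm.antidiagonal 3).over (w.1.adicCompletion L)) M}) => a g x) x₀
    (isOpen_setOf_act_apply_eq (fun g (x : {M : Submodule 𝒪[(w.1.adicCompletion L)] (Fin 3 → (w.1.adicCompletion L)) // IsVertex (galAdicCompletionMap (L := L) (IsCMField.complexConj L) hw) ϖ ((StdForm.antidiagonal 3).over (w.1.adicCompletion L)) M}) => a g x) (fun g h x => by rw [map_mul]; rfl) (fun x => by rw [map_one]; rfl) x₀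
      (isOpen_setOf_actionHom_apply_eq ha x₀)) hZc

include ha in
/-- **`hne` — A REGULAR-FREE FORM: IF `Z(γ)` IS COMPACT THEN `γ` FIXES A VERTEX** of the tree (unramified datum `hd`).  The finite, non-empty, `γ`-invariant set `Z(γ)·o₀` gives,
by ★ TITS, a fixed vertex or a swapped adjacent pair; the swap contradicts the `G`-invariant TYPE colouring (★ no inversion). [cite: Serre1980Trees, I.6.5 Prop. 26]
[cite: BruhatTits1972, §3.2] [cite: Kottwitz1986, §3] -/
theorem exists_apply_eq_self_of_isCompact_centralizer (hd : UnramifiedLocalConjDatum (galAdicCompletionMap (L := L) (IsCMField.complexConj L) hw) ϖ)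
    {γ : Gqs L v} (hZc : IsCompact ((Subgroup.centralizer ({γ} : Set (Gqs L v))) : Set (Gqs L v))) : ∃ o, a γ o = o := by
  obtain ⟨A, hA0, -⟩ := exists_apartmentEnum hd
  have hT := isTree_latticeGraph_three_of_unramified hd
  -- the finite `γ`-invariant set `S = Z(γ) · A 0`
  have hS := finite_image_centralizer_apply L v w hw eA ha hZc (A 0)
  have hSne : ((fun c : Gqs L v => a c (A 0)) '' ((Subgroup.centralizer ({γ} : Set (Gqs L v))) : Set (Gqs L v))).Nonempty :=
    ⟨a 1 (A 0), 1, Subgroup.one_mem _, rfl⟩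
  have hγZ : γ ∈ Subgroup.centralizer ({γ} : Set (Gqs L v)) := Subgroup.mem_centralizer_singleton_iff.2 rfl
  have hαS : ∀ s ∈ (fun c : Gqs L v => a c (A 0)) '' ((Subgroup.centralizer ({γ} : Set (Gqs L v))) : Set (Gqs L v)),
      a γ s ∈ (fun c : Gqs L v => a c (A 0)) '' ((Subgroup.centralizer ({γ} : Set (Gqs L v))) : Set (Gqs L v)) := by
    rintro _ ⟨c, hc, rfl⟩
    refine ⟨γ * c, Subgroup.mul_mem _ hγZ hc, ?_⟩
    simp only [map_mul]
    rfl
  rcases RootedTree.exists_fixed_or_swap_adj_of_finite_invariant hT (a γ) hS hSne hαS with h | ⟨u, u', hadj, hu, hu'⟩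
  · exact h
  · -- no inversion: the type colouring is preserved by `a γ = latticeGraphIso (eA γ)`
    exfalso
    obtain ⟨C, -, hC⟩ := exists_coloring_type hd.vσ hd.vϖ ((StdForm.antidiagonal 3).over (w.1.adicCompletion L))
    have h1 : C u' = C u := by rw [← hu, ha]; exact hC (eA γ) u
    exact C.valid hadj h1.symm

/-! ## §3 Finitely many fixed vertices (`hfin`): the orbit method -/

set_option maxHeartbeats 800000 in
include ha in
/-- **THE `γ`-FIXED VERTICES IN ONE `G`-ORBIT ARE FINITE** for `γ` regular with compact centraliser: they are images `g·x₀` of the FINITE set of fixed cosets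
`Fix_γ(G ⧸ Stab x₀)` (★ `finite_fixedBy_quotient_of_isClosed`; the class of a regular `γ` is closed ★, `Stab x₀` is compact open §2). [cite: Kottwitz1986, §3]
[cite: Rogawski1990, §12.5 pp. 182–184] -/
theorem finite_setOf_apply_eq_self_of_mem_orbit {γ : Gqs L v} (hreg : IsRegularElt (γ.val : GL (Fin 3) (LocalRing L v)))
    (hZc : IsCompact ((Subgroup.centralizer ({γ} : Set (Gqs L v))) : Set (Gqs L v))) (x₀ : {M : Submodule 𝒪[(w.1.adicCompletion L)] (Fin 3 → (w.1.adicCompletion L)) // IsVertex (galAdicCompletionMap (L := L) (IsCMField.complexConj L) hw) ϖ ((StdForm.antidiagonal 3).over (w.1.adicCompletion L)) M}) :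
    {x : {M : Submodule 𝒪[(w.1.adicCompletion L)] (Fin 3 → (w.1.adicCompletion L)) // IsVertex (galAdicCompletionMap (L := L) (IsCMField.complexConj L) hw) ϖ ((StdForm.antidiagonal 3).over (w.1.adicCompletion L)) M} | a γ x = x ∧ ∃ g : Gqs L v, a g x₀ = x}.Finite := by
  classical
  obtain ⟨P, hPmem, hPo, hPc⟩ := exists_stabilizer_isOpen_isCompact L v w hw eA ha x₀
  haveI : CompactSpace (Subgroup.centralizer ({γ} : Set (Gqs L v))) := isCompact_iff_compactSpace.1 hZc
  have hHf : ((qsForm L).map (cmConjRingHom L))ᵀ = qsForm L := UnitaryGroup.antidiagOne_isHermitian L 3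
  have hdetf : (qsForm L).det ≠ 0 := (UnitaryGroup.isUnit_antidiagOne_det L 3).ne_zero
  have hO := UnitaryGroup.isClosed_conjClass_local_of_isRegularElt L 3 (qsForm L) v hHf hdetf γ hreg
  have hF : (MulAction.fixedBy (Gqs L v ⧸ P) γ).Finite := finite_fixedBy_quotient_of_isClosed γ P hO hPo hPc
  refine (hF.image (fun q : Gqs L v ⧸ P => a q.out x₀)).subset ?_
  rintro x ⟨hx, g, rfl⟩
  refine ⟨(g : Gqs L v ⧸ P), ?_, ?_⟩
  · rw [MulAction.mem_fixedBy]
    change ((γ * g : Gqs L v) : Gqs L v ⧸ P) = (g : Gqs L v ⧸ P)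
    rw [eq_comm, QuotientGroup.eq]
    refine (hPmem _).2 ?_
    have hmul : ∀ (g h : Gqs L v) (x : {M : Submodule 𝒪[(w.1.adicCompletion L)] (Fin 3 → (w.1.adicCompletion L)) // IsVertex (galAdicCompletionMap (L := L) (IsCMField.complexConj L) hw) ϖ ((StdForm.antidiagonal 3).over (w.1.adicCompletion L)) M}), a (g * h) x = a g (a h x) := fun g h x => by rw [map_mul]; rfl
    -- `a (g⁻¹ (γ g)) x₀ = a g⁻¹ (a γ (a g x₀)) = a g⁻¹ (a g x₀) = x₀`
    rw [hmul, hmul, hx, ← hmul]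
    have h1 : g⁻¹ * g = 1 := inv_mul_cancel g
    rw [h1, map_one]
    rfl
  · obtain ⟨h, hh⟩ := QuotientGroup.mk_out_eq_mul P g
    show a ((g : Gqs L v ⧸ P).out) x₀ = a g x₀
    rw [hh, map_mul]
    show a g (a (h : Gqs L v) x₀) = a g x₀
    rw [(hPmem _).1 h.2]

set_option maxHeartbeats 800000 in
include ha in
/-- **`hfin` — THE `γ`-FIXED VERTEX SET IS FINITE** for `γ` regular with compact centraliser (unramified datum `hd`): the tree has TWO vertex orbits (types `0` and `2`, ★
`type_eq_zero_or_two_of_isVertexLattice_three`, with representatives `A 0`, `A (−1)` of the standard apartment ★ 39γ), and on each the fixed vertices are finite (§3).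
[cite: Kottwitz1986, §3] [cite: BruhatTits1972, §10] [cite: Rogawski1990, §12.5 pp. 182–184] -/
theorem finite_setOf_apply_eq_self_of_isCompact_centralizer (hd : UnramifiedLocalConjDatum (galAdicCompletionMap (L := L) (IsCMField.complexConj L) hw) ϖ)
    {γ : Gqs L v} (hreg : IsRegularElt (γ.val : GL (Fin 3) (LocalRing L v))) (hZc : IsCompact ((Subgroup.centralizer ({γ} : Set (Gqs L v))) : Set (Gqs L v))) :
    {x : {M : Submodule 𝒪[(w.1.adicCompletion L)] (Fin 3 → (w.1.adicCompletion L)) // IsVertex (galAdicCompletionMap (L := L) (IsCMField.complexConj L) hw) ϖ ((StdForm.antidiagonal 3).over (w.1.adicCompletion L)) M} | a γ x = x}.Finite := by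
  obtain ⟨A, hA0, hA1⟩ := exists_apartmentEnum hd
  refine ((finite_setOf_apply_eq_self_of_mem_orbit L v w hw eA ha hreg hZc (A 0)).union
    (finite_setOf_apply_eq_self_of_mem_orbit L v w hw eA ha hreg hZc (A (-1)))).subset ?_
  intro x hx
  obtain ⟨d, hxd⟩ := x.2
  rcases type_eq_zero_or_two_of_isVertexLattice_three hd.vσ hd.vϖ v_det_antidiagonal_three hxd with rfl | rfl
  · obtain ⟨u, k, -, hxu, -⟩ := exists_latticeGraphIso_apartmentEnum_of_isSelfDualLattice hd A hA0 hA1 hxd x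
    refine Or.inl ⟨hx, eA.symm u, ?_⟩
    rw [ha, ContinuousMulEquiv.apply_symm_apply]
    exact hxu.symm
  · obtain ⟨u, hxu⟩ := exists_eq_latticeGraphIso_apartmentEnum_neg_one hd A hA1 hxd
    refine Or.inr ⟨hx, eA.symm u, ?_⟩
    rw [ha, ContinuousMulEquiv.apply_symm_apply]
    exact hxu.symm

/-! ## §4 Finitely many fixed edges (`hfinE`) -/

include ha in
/-- **`hfinE` — A FIXED EDGE HAS FIXED ENDPOINTS, SO THE FIXED EDGES INJECT INTO `Fix × Fix`** (★ `head_mapEdgeSet_latticeGraphIso`: head and tail of the canonical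
orientation are equivariant; an edge is determined by its head and tail).  No ellipticity needed: finitely many fixed vertices ⇒ finitely many fixed edges.
[cite: Serre1980Trees, I.6.5 Prop. 26] [cite: BruhatTits1972, §10] -/
theorem finite_setOf_mapEdgeSet_eq_self_of_finite (τ : Orientation (latticeGraph (galAdicCompletionMap (L := L) (IsCMField.complexConj L) hw) ϖ ((StdForm.antidiagonal 3).over (w.1.adicCompletion L)))) (hτ : ∀ d, τ.tail d < τ.head d) {γ : Gqs L v}
    (hfin : {x : {M : Submodule 𝒪[(w.1.adicCompletion L)] (Fin 3 → (w.1.adicCompletion L)) // IsVertex (galAdicCompletionMap (L := L) (IsCMField.complexConj L) hw) ϖ ((StdForm.antidiagonal 3).over (w.1.adicCompletion L)) M} | a γ x = x}.Finite) :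
    {d : (latticeGraph (galAdicCompletionMap (L := L) (IsCMField.complexConj L) hw) ϖ ((StdForm.antidiagonal 3).over (w.1.adicCompletion L))).edgeSet | (a γ).mapEdgeSet d = d}.Finite := by
  have hsub : {d : (latticeGraph (galAdicCompletionMap (L := L) (IsCMField.complexConj L) hw) ϖ ((StdForm.antidiagonal 3).over (w.1.adicCompletion L))).edgeSet | (a γ).mapEdgeSet d = d} ⊆
      (fun d : (latticeGraph (galAdicCompletionMap (L := L) (IsCMField.complexConj L) hw) ϖ ((StdForm.antidiagonal 3).over (w.1.adicCompletion L))).edgeSet => (τ.head d, τ.tail d)) ⁻¹' ({x : {M : Submodule 𝒪[(w.1.adicCompletion L)] (Fin 3 → (w.1.adicCompletion L)) // IsVertex (galAdicCompletionMap (L := L) (IsCMField.complexConj L) hw) ϖ ((StdForm.antidiagonal 3).over (w.1.adicCompletion L)) M} | a γ x = x} ×ˢ {x : {M : Submodule 𝒪[(w.1.adicCompletion L)] (Fin 3 → (w.1.adicCompletion L)) // IsVertex (galAdicCompletionMap (L := L) (IsCMField.complexConj L) hw) ϖ ((StdForm.antidiagonal 3).over (w.1.adicCompletion L)) M} | a γ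 x = x}) := by
    intro d hd'
    have hht := head_mapEdgeSet_latticeGraphIso (galAdicCompletionMap (L := L) (IsCMField.complexConj L) hw) ϖ ((StdForm.antidiagonal 3).over (w.1.adicCompletion L)) hτ (eA γ) d
    rw [← ha] at hht
    rw [Set.mem_setOf_eq] at hd'
    rw [hd'] at hht
    exact ⟨hht.1.symm, hht.2.symm⟩
  refine (Set.Finite.preimage ?_ (hfin.prod hfin)).subset hsub
  rintro d - d' - hdd'
  simp only [Prod.mk.injEq] at hdd'
  apply Subtype.ext
  rw [← τ.mk_head_tail d, ← τ.mk_head_tail d', hdd'.1, hdd'.2]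

/-! ## §5 The elliptic forms: `γ ∉ Ω` and the pin-shaped junctions -/

include ha in
/-- **`hne` FOR A REGULAR `γ ∉ Ω`** (the regular hyperbolic set): `γ` fixes a vertex (★ `isCompact_centralizer_of_not_mem_hyperbolicSet` + §2).
[cite: Rogawski1990, §12.5 p. 184; §3.6 pp. 28–31] [cite: Serre1980Trees, I.6.5 Prop. 26] -/
theorem exists_apply_eq_self_of_not_mem_hyperbolicSet (hns : ∀ w' : PlacesOver L v, IsCMField.complexConj L • w'.1 = w'.1)
    (hd : UnramifiedLocalConjDatum (galAdicCompletionMap (L := L) (IsCMField.complexConj L) hw) ϖ) {γ : Gqs L v} (hreg : IsRegularElt (γ.val : GL (Fin 3) (LocalRing L v)))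
    (hΩ : γ ∉ hyperbolicSet L v) : ∃ o, a γ o = o :=
  exists_apply_eq_self_of_isCompact_centralizer L v w hw eA ha hd (F0P3cStCharTSEllCartanCompact.isCompact_centralizer_of_not_mem_hyperbolicSet L v hns hreg hΩ)

include ha in
/-- **`hfin` FOR A REGULAR `γ ∉ Ω`**: finitely many fixed vertices. [cite: Kottwitz1986, §3] [cite: Rogawski1990, §12.5 pp. 182–184] -/
theorem finite_setOf_apply_eq_self_of_not_mem_hyperbolicSet (hns : ∀ w' : PlacesOver L v, IsCMField.complexConj L • w'.1 = w'.1)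
    (hd : UnramifiedLocalConjDatum (galAdicCompletionMap (L := L) (IsCMField.complexConj L) hw) ϖ) {γ : Gqs L v} (hreg : IsRegularElt (γ.val : GL (Fin 3) (LocalRing L v)))
    (hΩ : γ ∉ hyperbolicSet L v) : {x : {M : Submodule 𝒪[(w.1.adicCompletion L)] (Fin 3 → (w.1.adicCompletion L)) // IsVertex (galAdicCompletionMap (L := L) (IsCMField.complexConj L) hw) ϖ ((StdForm.antidiagonal 3).over (w.1.adicCompletion L)) M} | a γ x = x}.Finite :=
  finite_setOf_apply_eq_self_of_isCompact_centralizer L v w hw eA ha hd hreg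
    (F0P3cStCharTSEllCartanCompact.isCompact_centralizer_of_not_mem_hyperbolicSet L v hns hreg hΩ)

include ha in
/-- **THE JUNCTION AT THE PINS** (`hE : ellG = G^r ∖ Ω`): for `γ ∈ 𝔇.ellG` the three 41g-H binders `hne`, `hfin`, `hfinE` hold. [cite: Rogawski1990, §12.5 pp. 182–187]
[cite: Kottwitz1986, §3] [cite: SchneiderStuhler1997, Thm. III.4.16] -/
theorem ellipticFixedTree_of_mem_ellG (hns : ∀ w' : PlacesOver L v, IsCMField.complexConj L • w'.1 = w'.1)
    (hd : UnramifiedLocalConjDatum (galAdicCompletionMap (L := L) (IsCMField.complexConj L) hw) ϖ) (τ : Orientation (latticeGraph (galAdicCompletionMap (L := L) (IsCMField.complexConj L) hw) ϖ ((StdForm.antidiagonal 3).over (w.1.adicCompletion L)))) (hτ : ∀ d, τ.tail d < τ.head d)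
    [MeasurableSpace (Gqs L v)]
    [∀ γ : Gqs L v, MeasurableSpace (Gqs L v ⧸ Subgroup.centralizer ({γ} : Set (Gqs L v)))] [MeasurableSpace (Gqs L v ⧸ Subgroup.center (Gqs L v))]
    {H' : Type} [Group H'] [TopologicalSpace H'] [IsTopologicalGroup H'] [MeasurableSpace H']
    (𝔇 : EllipticData (Gqs L v) H')
    (hE : ∀ γ : Gqs L v, γ ∈ 𝔇.ellG ↔ IsRegularElt (γ.val : GL (Fin 3) (UnitaryGroup.LocalRing L v)) ∧ γ ∉ hyperbolicSet L v)
    {γ : Gqs L v} (hγ : γ ∈ 𝔇.ellG) :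
    (∃ o, a γ o = o) ∧ {x : {M : Submodule 𝒪[(w.1.adicCompletion L)] (Fin 3 → (w.1.adicCompletion L)) // IsVertex (galAdicCompletionMap (L := L) (IsCMField.complexConj L) hw) ϖ ((StdForm.antidiagonal 3).over (w.1.adicCompletion L)) M} | a γ x = x}.Finite ∧ {d : (latticeGraph (galAdicCompletionMap (L := L) (IsCMField.complexConj L) hw) ϖ ((StdForm.antidiagonal 3).over (w.1.adicCompletion L))).edgeSet | (a γ).mapEdgeSet d = d}.Finite := by
  obtain ⟨hreg, hΩ⟩ := (hE γ).1 hγ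
  have hfin := finite_setOf_apply_eq_self_of_not_mem_hyperbolicSet L v w hw eA ha hns hd hreg hΩ
  exact ⟨exists_apply_eq_self_of_not_mem_hyperbolicSet L v w hw eA ha hns hd hreg hΩ, hfin,
    finite_setOf_mapEdgeSet_eq_self_of_finite L v w hw eA ha τ hτ hfin⟩

omit ha in
/-- **(d2) NON-ELLIPTIC REGULAR ⇒ NON-COMPACT CENTRALISER** at the pins (`hreg : regG = G^r`, `hE : ellG = G^r ∖ Ω`; ★ `isCompact_centralizer_iff_not_mem_hyperbolicSet`) — the
`hnc` input of ★ `EllMassG.orbInt_eq_zero_of_mem_regG_of_not_mem_ellG` ∕ 47e-E3. [cite: Rogawski1990, §12.5 p. 184; §3.6 pp. 28–31] -/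
theorem not_isCompact_centralizer_of_mem_regG_of_not_mem_ellG (hns : ∀ w' : PlacesOver L v, IsCMField.complexConj L • w'.1 = w'.1)
    [MeasurableSpace (Gqs L v)]
    [∀ γ : Gqs L v, MeasurableSpace (Gqs L v ⧸ Subgroup.centralizer ({γ} : Set (Gqs L v)))] [MeasurableSpace (Gqs L v ⧸ Subgroup.center (Gqs L v))]
    {H' : Type} [Group H'] [TopologicalSpace H'] [IsTopologicalGroup H'] [MeasurableSpace H']
    (𝔇 : EllipticData (Gqs L v) H')
    (hR : ∀ γ : Gqs L v, γ ∈ 𝔇.regG ↔ IsRegularElt (γ.val : GL (Fin 3) (UnitaryGroup.LocalRing L v)))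
    (hE : ∀ γ : Gqs L v, γ ∈ 𝔇.ellG ↔ IsRegularElt (γ.val : GL (Fin 3) (UnitaryGroup.LocalRing L v)) ∧ γ ∉ hyperbolicSet L v)
    {γ : Gqs L v} (hγr : γ ∈ 𝔇.regG) (hγe : γ ∉ 𝔇.ellG) :
    ¬ IsCompact ((Subgroup.centralizer ({γ} : Set (Gqs L v))) : Set (Gqs L v)) := by
  intro hZc
  have hreg := (hR γ).1 hγr
  exact hγe ((hE γ).2 ⟨hreg, (F0P3cStCharTSEllCartanCompact.isCompact_centralizer_iff_not_mem_hyperbolicSet L v hns hreg).1 hZc⟩)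

end Datum

end Summit.HodgeConjecture.HodgeConjecture.Cruxes.H413.F0P3cStCharTSEllipticFixedTree

end
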